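import Literature.AlgebraicGeometry.Resolution.PointBlowupResiduallyFinite
import HarnessLib

/-!
# `H^{(N)}(R^{(1)}) ≤ H^{(N)}(R)` (`N ≥ 1`) for a quadratic transform with finite residue extension
# (CJS 2020, Thm. 3.10 (1), Bennett–Hironaka form, ring level — the input of HIO Thm. (30.2))

Topic: `Literature/AlgebraicGeometry/Resolution`. Cossart–Jannsen–Saito, LNM 2270, Thm. 3.10 (1),
Bennett–Hironaka form `H^{(1+δ)}(𝒪_{X',x'}) ≤ H^{(1)}(𝒪_{X,x})` (p. 44), in the case `δ = 0`:
`PointBlowupResiduallyFinite.lean` proves it for the localization `L = B_𝔴` of a chart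
`B = R[𝔪t]_{(c_i t)}` of `Bl_𝔪(Spec R)` at a prime `𝔴 ⊇ 𝔪B` under the ring-level hypothesis
"`k(L)` is generated over `k = R/𝔪` by finitely many integral elements" (a finite set `T` with
generation and integrality data). This file records the same statements under the plain
hypothesis that **the residue field extension `R/𝔪 → L/𝔪_L` is finite**, stated without any
auxiliary data as the finiteness of the composite ring map `R → L → L/𝔪_L`
(`((residue L).comp σ).Finite`) — the form in which the inequality is quoted in the proof of
Bennett's inequality `H^{(0)}[R] ≥ H^{(d)}[R_𝔭]` by resolving the curve `R/𝔭` through quadratic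
transforms along `𝔭` (Herrmann–Ikeda–Orbanz, Thm. (30.2), p. 251–252: "`R^{(c)}` dominates
`N_𝔫`", whose residue field is finite over `k`):

* `finite_residueFieldMap_of_finite_residue_comp` — `R → k(L)` finite ⇒ `k → k(L)` finite;
* `hilbertSamuelFun_le_of_abstractChart_of_finite_residue`,
  `hilbertSamuelFun_le_of_isLocalization_chart_of_finite_residue` —
  **`H^{(N)}_L ≤ H^{(N)}_R` for all `N ≥ 1`** when `R → L/𝔪_L` is finite.

(The sharp form `H^{(0)} ≤ H^{(0)}` (Singh) is `PointBlowupResiduallySeparable.lean` for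
separable residue extensions.) No definitions and no named facts are introduced.

## Sources

* V. Cossart, U. Jannsen, S. Saito, LNM 2270 (2020), Thm. 3.10 (1) (p. 43–44), proof pp. 46–47.
  [CossartJannsenSaito2020]
* M. Herrmann, S. Ikeda, U. Orbanz, *Equimultiplicity and Blowing up*, Springer 1988, proof of
  Thm. (30.2) (p. 251–252), Thm. (29.1). [HerrmannIkedaOrbanz1988]
-/

noncomputable section

open Polynomial IsLocalRing Literature.RingTheory.HilbertSamuel

namespace Literature.AlgebraicGeometry.Resolution

universe u

/-- **`R → k(L)` finite ⇒ `k(R) → k(L)` finite** for a local homomorphism `σ : R → L`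
(`k(R) → k(L)` composed with the surjection `R → k(R)` is `R → L → k(L)`). [folklore] -/
theorem finite_residueFieldMap_of_finite_residue_comp {R L : Type u} [CommRing R] [IsLocalRing R]
    [CommRing L] [IsLocalRing L] (σ : R →+* L) [IsLocalHom σ]
    (hfin : ((residue L).comp σ).Finite) : (ResidueField.map σ).Finite := by
  refine RingHom.Finite.of_comp_finite (f := residue R) ?_
  have : (ResidueField.map σ).comp (residue R) = (residue L).comp σ := RingHom.ext fun _ => rfl
  rw [this]
  exact hfin

/-- **`H^{(N)}_L ≤ H^{(N)}_R` for all `N ≥ 1` for localizations of abstract charts of `Bl_𝔪(Spec R)`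
at primes over `𝔪` with FINITE residue extension** (`R → L/𝔪_L` finite), from
`hilbertSamuelFun_le_of_abstractChart_of_residuallyFinite` (lift a spanning set of `k(L)` over `k`;
its elements are integral). [cite: CossartJannsenSaito2020, Thm. 3.10 (1), proof pp. 46–47] -/
theorem hilbertSamuelFun_le_of_abstractChart_of_finite_residue {R A L : Type u} [CommRing R]
    [IsLocalRing R] [IsNoetherianRing R] [CommRing A] [CommRing L] [IsLocalRing L]
    [IsNoetherianRing L] {n : ℕ} (c : Fin n → R) (i : Fin n) (ψ : R →+* A) (e : Fin n → A)
    (hu : e i = 1)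
    (hdiv : ∀ (m : ℕ) (F : MvPolynomial (Fin n) R), F.IsHomogeneous m →
      MvPolynomial.eval c F ∈ Ideal.span (Set.range c) ^ (m + 1) →
        MvPolynomial.eval₂Hom ψ e F ∈ Ideal.span {ψ (c i)})
    (hgen : ∀ b : A, ∃ (m : ℕ) (F : MvPolynomial (Fin n) R), F.IsHomogeneous m ∧
      MvPolynomial.eval₂Hom ψ e F = b)
    (hI : ∀ r ∈ Ideal.span (Set.range c), ψ r ∈ Ideal.span {ψ (c i)})
    (hc : Ideal.span (Set.range c) = maximalIdeal R) (𝔴 : Ideal A) [𝔴.IsPrime]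
    (h𝔴 : 𝔴.comap ψ = maximalIdeal R) [Algebra A L] [IsLocalization.AtPrime L 𝔴]
    (σ : R →+* L) (hσ : ∀ r, algebraMap A L (ψ r) = σ r)
    (hfin : ((residue L).comp σ).Finite) (N : ℕ) (hN : 1 ≤ N) :
    hilbertSamuelFun L N ≤ hilbertSamuelFun R N := by
  have hσ' : (algebraMap A L).comp ψ = σ := RingHom.ext hσ
  haveI : IsLocalHom σ := hσ' ▸ isLocalHom_algebraMap_comp ψ 𝔴 h𝔴 (L := L)
  obtain ⟨T, hTgen, hTint⟩ := exists_residuallyFinite_of_finite_residueField σ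
    (finite_residueFieldMap_of_finite_residue_comp σ hfin)
  exact hilbertSamuelFun_le_of_abstractChart_of_residuallyFinite c i ψ e hu hdiv hgen hI hc 𝔴 h𝔴
    σ hσ T hTgen hTint N hN

section Chart

variable {R : Type u} [CommRing R] {n : ℕ} (c : Fin n → R) (i : Fin n)

-- the raw forms of `chartRing c i`, `chartBase c i`, `chartGen c i j` (`BlowupChartRsop.lean`)
local notation3 "𝓑" => HomogeneousLocalization.Away (reesGrading (Ideal.span (Set.range c)))
  (reesT (c i) (Ideal.mem_span_range_self (f := c) (x := i)))
local notation3 "φ" => reesChartBase (c i) (Ideal.mem_span_range_self (f := c) (x := i))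
local notation3 "e[" j "]" =>
  HomogeneousLocalization.Away.mk (reesGrading (Ideal.span (Set.range c)))
    (reesT_mem (c i) (Ideal.mem_span_range_self (f := c) (x := i))) 1
    (reesT (c j) (Ideal.mem_span_range_self (f := c) (x := j))) (reesT_mem_one_smul c j)

/-- **CJS Thm. 3.10 (1), Bennett–Hironaka form, for a quadratic transform with finite residue
extension:** `(R, 𝔪)` Noetherian local, `𝔪 = (c_1, …, c_n)`, `B = R[𝔪t]_{(c_i t)}` a chart of
`Bl_𝔪(Spec R)`, `𝔴 ⊆ B` a prime over `𝔪`, `L = B_𝔴` (a quadratic transform of `R`) with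
`R → L/𝔪_L` finite (e.g. `L` the quadratic transform along a prime `𝔭` with `dim R/𝔭 = 1`
dominated by the finite normalization of `R/𝔭`, HIO Thm. (30.2)). Then `H^{(N)}_L ≤ H^{(N)}_R` for
all `N ≥ 1`. [cite: CossartJannsenSaito2020, Thm. 3.10 (1), proof pp. 46–47] [cite: HerrmannIkedaOrbanz1988, Thm. (29.1)] -/
theorem hilbertSamuelFun_le_of_isLocalization_chart_of_finite_residue [IsLocalRing R]
    [IsNoetherianRing R] (hc : Ideal.span (Set.range c) = maximalIdeal R) (𝔴 : Ideal 𝓑)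
    [𝔴.IsPrime] (h𝔴 : 𝔴.comap φ = maximalIdeal R)
    (L : Type u) [CommRing L] [IsLocalRing L] [IsNoetherianRing L] [Algebra 𝓑 L]
    [IsLocalization.AtPrime L 𝔴] (σ : R →+* L)
    (hσ : ∀ r, (algebraMap 𝓑 L : 𝓑 →+* L) (φ r) = σ r)
    (hfin : ((residue L).comp σ).Finite) (N : ℕ) (hN : 1 ≤ N) :
    hilbertSamuelFun L N ≤ hilbertSamuelFun R N :=
  hilbertSamuelFun_le_of_abstractChart_of_finite_residue c i φ (fun j => e[j])
    (chartGen_self c i)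
    (fun _ _ hF hFc => by
      obtain ⟨G, -, hG⟩ := exists_eval₂Hom_eq_mul_of_eval_mem_pow_succ c i hF hFc
      rw [hG]
      exact Ideal.mul_mem_right _ _ (Ideal.mem_span_singleton_self _))
    (fun b => by
      obtain ⟨m, F, hF, hFb⟩ := exists_isHomogeneous_eval₂_eq c i b
      exact ⟨m, F, hF, hFb⟩)
    (fun _ hr => reesChartBase_mem_span_of_mem c i hr) hc 𝔴 h𝔴 σ hσ hfin N hN

end Chart

end Literature.AlgebraicGeometry.Resolution

end
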